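import Mathlib
import Literature.NumberTheory.LFunctions.Zhang2022.SkeletonSetting
import Literature.NumberTheory.LFunctions.Zhang2022.Section8Defs
import Literature.NumberTheory.LFunctions.Zhang2022.Section18Defs
import Literature.NumberTheory.LFunctions.Zhang2022.Section17Lemma171
import Literature.NumberTheory.LFunctions.RamanujanDivisorSquare
import HarnessLib

/-!
# Zhang (2022), typed skeleton II: the objects — `Ψ₁` (§3), the zeros `𝔷(ψ)`, `Y`, `M`, `𝔠*`,
# the Dirichlet polynomials `H₁, H₂, J₁, J₂`, and the discrete means `Ξ₁*, Ξ₂*, Ξ₃*, Ξ₁, Ξ_J,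
# Ξ₁₁, Ξ₁₂, Ξ₁₃`

Topic `Literature/NumberTheory/LFunctions/Zhang2022` (Landau–Siegel audit tree; verdict-neutral).
Y. Zhang, *Discrete mean estimates and the Landau–Siegel zero*, arXiv:2211.02515v1 (2022)
[Zhang2022LandauSiegel] — **an unrefereed manuscript under adjudication; nothing here asserts or
denies any of its claims.** This file only DEFINES, as functions of the modulus `D`, the real
primitive character `χ (mod D)` and the unspecified constant `c′` of (2.13), the objects about
which the manuscript's Propositions 2.1–2.6 speak (they are typed in `SkeletonPropositions`):

| decl | display | printed object |
|---|---|---|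
| `beta1 … beta3`, `beta6`, `beta7` | (2.13), (2.22) | `β₁ = iα(1−5c′α𝓛)`, `β₂ = 2iα(1+c′α𝓛)`, `β₃ = 3iα(1−c′α𝓛)`, `β₆ = 3iα/2`, `β₇ = 5iα/2` |
| `nu`, `ups`, `nu20`, `ups20`, `sig`, `X1 … X4` | §3 (3.1)–(3.6) | `ν = 1∗χ`, `υ = μ∗μχ`, `ν₂₀`, `υ₂₀`, `ς`, `X₁(x,ψ) … X₄(x,ψ)` |
| `Ineq34`, `Ineq35`, `Ineq36`, `PsiOne`, `PsiTwo` | (3.4)–(3.6), §3 p. 7 | the inequalities defining `Ψ₁`; `Ψ₂ = Ψ ∖ Ψ₁` |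
| `zeroSet` | (2.14) | `𝔷(ψ)` = zeros of `L(s,ψ)` with `|σ−½| < ½`, `|t − 2πt₀| < 𝓛₁` |
| `psiChi`, `prodZeroSetOmega` | §2 p. 4 | `ψχ (mod Dp)`; zeros of `L(s,ψ)L(s,ψχ)` in `Ω` |
| `Yroot`, `Mfun`, `cstar` | §2 p. 5, (2.14)ff | `Y(s,ψ)² = Z(s,ψ)⁻¹`, `M = YL`, `𝔠*(ρ,ψ) = −iM(ρ+β₁)M(ρ+β₂)M(ρ+β₃)/M′(ρ)` |
| `omegaW` | (2.15) | `ω(s)` (the tree's `SmoothWeight.omega 𝓛₂ t₀`) |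
| `vk1, vk2, vk3`, `H11, H12, H13`, `H1, H2` | (2.23)–(2.27), (8.6) | `ϰⱼ(n)`, `H₁ⱼ(s,ψ)`, `H₁ = H₁₁ + ι₂H₁₂`, `H₂ = ῑ₃H₁₃ + ῑ₄H₁₂` |
| `ftilde`, `J1`, `J2` | (2.28)–(2.30) | the tent `f̃`, `J₁(s,ψ)`, `J₂(s,ψ)` |
| `Zpc` | (2.2) | `Z(s,ψχ)` (the tree's `GammaFactor.Zfac`) |
| `xiStar1`, `xiStar2`, `xiStar3` | (2.17), (2.19), (2.20) | `Ξ₁*`, `Ξ₂*`, `Ξ₃*` |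
| `xi1`, `xiJ`, `xi11`, `xi12`, `xi13` | (2.32), (2.33), (8.3)–(8.5) | the left sides of (2.32), (2.33); `Ξ₁₁, Ξ₁₂, Ξ₁₃` |

Design notes. (1) `Y(s,ψ)` is "an analytic function with `Y² = Z⁻¹` on the upper half-plane" —
we take `Classical.choose` of the tree's existence theorem `GammaFactor.exists_sqrt_inv_Zfac`; the
manuscript notes the `±` ambiguity and that `𝔠*` does not depend on it (four factors of `Y`).
(2) The double sums `Σ_{ψ∈Ψ₁} Σ_{ρ∈𝔷(ψ)}` are `Finset` sums: `Ψ₁` is a subset of the finite type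
`Chr D`, and `𝔷(ψ)` — the zeros of the entire, not identically vanishing `L(·,ψ)` in a bounded box —
is finite; `finsetOf` turns a finite set into a `Finset` (and an infinite one into `∅`, a junk
value; finiteness of `𝔷(ψ)` is the node `ZerosFinite` of `SkeletonPropositions`). (3) `𝔠*(ρ,ψ)` and
`ω(ρ)` are real on the critical line ((2.11)–(2.12), tree `GammaFactor.calCstar_im_eq_zero`; (2.15)
"positive for `σ = 1/2`"); the real-valued means `Ξ₂*, Ξ₃*, Ξ₁, Ξ_J, Ξ₁₁, Ξ₁₂` use `Re 𝔠*` and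
`Re ω`, the complex ones `Ξ₁*, Ξ₁₃` use `𝔠*, ω` themselves. (4) `ν₂₀` is the 20-fold convolution
power of the TRUNCATION `ν·1_{n ≤ D⁴}` (it is defined through `F(s,ψ)²⁰`, `F = Σ_{n≤D⁴} νψn^{−s}`).

## References

* Y. Zhang, arXiv:2211.02515v1 (2022), §2 (2.11)–(2.33), §3, §8 (8.1)–(8.6).
  [cite: Zhang2022LandauSiegel, §§2, 3, 8]
-/

noncomputable section

open Complex Real ComplexConjugate

namespace Literature.NumberTheory.LFunctions.Zhang2022.Skeleton

/-! ## A finite set as a `Finset` -/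

open scoped Classical in
/-- A set as a `Finset`: its elements if it is finite, `∅` otherwise (junk value). [folklore] -/
def finsetOf {α : Type*} (S : Set α) : Finset α := if h : S.Finite then h.toFinset else ∅

/-- For a finite set, `finsetOf S` has the same members as `S`. [cite: Zhang2022LandauSiegel, §2 (2.16)] -/
theorem mem_finsetOf {α : Type*} {S : Set α} (h : S.Finite) {a : α} : a ∈ finsetOf S ↔ a ∈ S := by
  rw [finsetOf, dif_pos h, Set.Finite.mem_toFinset]

/-- Membership in `finsetOf S` implies membership in `S` (vacuously if `S` is infinite: then
`finsetOf S = ∅`). [cite: Zhang2022LandauSiegel, §2 (2.16)] -/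
theorem mem_of_mem_finsetOf {α : Type*} {S : Set α} {a : α} (h : a ∈ finsetOf S) : a ∈ S := by
  unfold finsetOf at h
  split_ifs at h with hS
  · exact hS.mem_toFinset.mp h
  · simp at h

/-! ## The shifts `β_j` (2.13), (2.22) -/

variable (c' : ℝ) (D : ℕ)

/-- `β₁ = iα(1 − 5c′α𝓛)` (2.13); `c′ > 0` is the "(large) constant" of the restated gap assertion.
[cite: Zhang2022LandauSiegel, §2 (2.13)] -/
def beta1 : ℂ := I * (alpha D : ℂ) * (1 - 5 * c' * alpha D * ell D : ℝ)

/-- `β₂ = 2iα(1 + c′α𝓛)` (2.13). [cite: Zhang2022LandauSiegel, §2 (2.13)] -/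
def beta2 : ℂ := 2 * I * (alpha D : ℂ) * (1 + c' * alpha D * ell D : ℝ)

/-- `β₃ = 3iα(1 − c′α𝓛)` (2.13). [cite: Zhang2022LandauSiegel, §2 (2.13)] -/
def beta3 : ℂ := 3 * I * (alpha D : ℂ) * (1 - c' * alpha D * ell D : ℝ)

/-- `β₆ = 3iα/2` (2.22). [cite: Zhang2022LandauSiegel, §2 (2.22)] -/
def beta6 : ℂ := 3 * I * (alpha D : ℂ) / 2

/-- `β₇ = 5iα/2` (2.22). [cite: Zhang2022LandauSiegel, §2 (2.22)] -/
def beta7 : ℂ := 5 * I * (alpha D : ℂ) / 2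

/-! ## §3: `ν`, `υ`, the sums `X₁ … X₄`, the inequalities (3.4)–(3.6), and `Ψ₁` -/

variable {D} [NeZero D] (χ : DirichletCharacter ℂ D)

/-- `ν(n)`: `ζ(s)L(s,χ) = Σ ν(n)n^{−s}`, i.e. `ν = 1 ∗ χ`, `ν(n) = Σ_{d∣n} χ(d)` — the tree's
`divisorSumChar χ` (so that the tree's Lemma 3.1, `Lemma31.lemma_3_1_complex`, speaks about this `ν`).
[cite: Zhang2022LandauSiegel, §3 p. 6] -/
def nu : ℕ → ℂ := Literature.NumberTheory.LFunctions.divisorSumChar χ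

/-- `υ(n)`: `ζ(s)⁻¹L(s,χ)⁻¹ = Σ υ(n)n^{−s}`, i.e. `υ = μ ∗ μχ`. [cite: Zhang2022LandauSiegel, §3 p. 6] -/
def ups : ℕ → ℂ :=
  LSeries.convolution (fun n => (ArithmeticFunction.moebius n : ℂ))
    (fun n => (ArithmeticFunction.moebius n : ℂ) * χ (n : ZMod D))

/-- Truncation of a coefficient sequence to `n ≤ N`. [folklore] -/
def trunc (N : ℕ) (a : ℕ → ℂ) : ℕ → ℂ := fun n => if n ≤ N then a n else 0

/-- `k`-fold Dirichlet convolution power of a sequence (`a^{∗0} = δ₁`). [folklore] -/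
def convPow (a : ℕ → ℂ) : ℕ → (ℕ → ℂ)
  | 0 => fun n => if n = 1 then 1 else 0
  | k + 1 => LSeries.convolution a (convPow a k)

/-- `ν₂₀(n)`: `F(s,ψ)²⁰ = Σ_{n≤D⁸⁰} ν₂₀(n)ψ(n)n^{−s}` where `F(s,ψ) = Σ_{n≤D⁴} ν(n)ψ(n)n^{−s}`, i.e. the
20-fold convolution power of `ν·1_{n≤D⁴}`. [cite: Zhang2022LandauSiegel, §3 p. 7] -/
def nu20 : ℕ → ℂ := convPow (trunc (D ^ 4) (nu χ)) 20

/-- `υ₂₀(n)`: `G(s,ψ)²⁰ = Σ_{n≤D⁸⁰} υ₂₀(n)ψ(n)n^{−s}`, `G(s,ψ) = Σ_{n≤D⁴} υ(n)ψ(n)n^{−s}`.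
[cite: Zhang2022LandauSiegel, §3 p. 7] -/
def ups20 : ℕ → ℂ := convPow (trunc (D ^ 4) (ups χ)) 20

/-- `ς(n) = Σ_{n=lm, l,m≤D⁴} ν(l)υ(m)` (so `F(s,ψ)G(s,ψ) − 1 = Σ_{D⁴<n≤D⁸} ς(n)ψ(n)n^{−s}`).
[cite: Zhang2022LandauSiegel, §3 p. 7] -/
def sig : ℕ → ℂ := LSeries.convolution (trunc (D ^ 4) (nu χ)) (trunc (D ^ 4) (ups χ))

variable (x : Chr D)

/-- `X₁(x,ψ) = Σ_{n≤x} ν₂₀(n)ψ(n)n^{−s₀}`. [cite: Zhang2022LandauSiegel, §3 p. 7] -/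
def X1 (y : ℝ) : ℂ :=
  ∑ n ∈ Finset.Icc 1 ⌊y⌋₊, nu20 χ n * x.ψ (n : ZMod x.p) * (n : ℂ) ^ (-s0 D)

/-- `X₂(x,ψ) = Σ_{n≤x} υ₂₀(n)ψ(n)n^{−s₀}`. [cite: Zhang2022LandauSiegel, §3 p. 7] -/
def X2 (y : ℝ) : ℂ :=
  ∑ n ∈ Finset.Icc 1 ⌊y⌋₊, ups20 χ n * x.ψ (n : ZMod x.p) * (n : ℂ) ^ (-s0 D)

/-- `X₃(x,ψ) = Σ_{D⁴<n≤x} ν(n)ψ(n)n^{−s₀}` (`x > D⁴`). [cite: Zhang2022LandauSiegel, §3 p. 7] -/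
def X3 (y : ℝ) : ℂ :=
  ∑ n ∈ Finset.Ioc (D ^ 4) ⌊y⌋₊, nu χ n * x.ψ (n : ZMod x.p) * (n : ℂ) ^ (-s0 D)

/-- `X₄(x,ψ) = Σ_{D⁴<n≤x} ς(n)ψ(n)n^{−s₀}` (`x > D⁴`). [cite: Zhang2022LandauSiegel, §3 p. 7] -/
def X4 (y : ℝ) : ℂ :=
  ∑ n ∈ Finset.Ioc (D ^ 4) ⌊y⌋₊, sig χ n * x.ψ (n : ZMod x.p) * (n : ℂ) ^ (-s0 D)

/-- **(3.4)**: `|X₁(D⁸⁰,ψ)| + |X₂(D⁸⁰,ψ)| + ∫₁^{D⁸⁰} (|X₁(x,ψ)| + |X₂(x,ψ)|) dx/x < 𝓛¹¹⁷¹`.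
[cite: Zhang2022LandauSiegel, §3 (3.4)] -/
def Ineq34 : Prop :=
  ‖X1 χ x ((D : ℝ) ^ 80)‖ + ‖X2 χ x ((D : ℝ) ^ 80)‖
    + ∫ y in (1 : ℝ)..(D : ℝ) ^ 80, (‖X1 χ x y‖ + ‖X2 χ x y‖) / y < ell D ^ 1171

/-- **(3.5)**: `|X₃(P²,ψ)| + ∫_{D⁴}^{P²} |X₃(x,ψ)| dx/x < 𝓛⁻⁵⁸⁵`. [cite: Zhang2022LandauSiegel, §3 (3.5)] -/
def Ineq35 : Prop :=
  ‖X3 χ x (bigP D ^ 2)‖ + ∫ y in (D : ℝ) ^ 4..bigP D ^ 2, ‖X3 χ x y‖ / y < (ell D ^ 585)⁻¹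

/-- **(3.6)**: `|X₄(D⁸,ψ)| + ∫_{D⁴}^{D⁸} |X₄(x,ψ)| dx/x < 𝓛⁻⁶³³`. [cite: Zhang2022LandauSiegel, §3 (3.6)] -/
def Ineq36 : Prop :=
  ‖X4 χ x ((D : ℝ) ^ 8)‖ + ∫ y in (D : ℝ) ^ 4..(D : ℝ) ^ 8, ‖X4 χ x y‖ / y < (ell D ^ 633)⁻¹

/-- **`Ψ₁`** (§3 p. 7): "Let `Ψ₁` be the subset of `Ψ` such that `ψ ∈ Ψ₁` if and only if the
inequalities (3.4), (3.5) and (3.6) simultaneously hold." [cite: Zhang2022LandauSiegel, §3 p. 7] -/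
def PsiOne : Set (Chr D) := {x | Ineq34 χ x ∧ Ineq35 χ x ∧ Ineq36 χ x}

/-- **`Ψ₂`**, "the complement of `Ψ₁` in `Ψ`" (Proposition 2.1). [cite: Zhang2022LandauSiegel, §2 Prop. 2.1] -/
def PsiTwo : Set (Chr D) := (PsiOne χ)ᶜ

/-! ## The zeros, `ψχ`, `Y`, `M`, `𝔠*`, `ω` -/

omit [NeZero D] in
/-- **`𝔷(ψ)`** (2.14): the zeros of `L(s,ψ)` in the region `|σ − 1/2| < 1/2`, `|t − 2πt₀| < 𝓛₁`.
[cite: Zhang2022LandauSiegel, §2 (2.14)] -/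
def zeroSet (D : ℕ) (x : Chr D) : Set ℂ :=
  {ρ | |ρ.re - 1 / 2| < 1 / 2 ∧ |ρ.im - 2 * π * t0 D| < ell1 D ∧ x.ψ.LFunction ρ = 0}

/-- The product modulus `Dp` is non-zero. [folklore] -/
instance instNeZeroMul : NeZero (D * x.p) := ⟨mul_ne_zero (NeZero.ne D) (NeZero.ne x.p)⟩

/-- The character `ψχ (mod Dp)` ("`χψ` is a primitive character (mod `Dp`)", §4 p. 8): the product
of `χ` and `ψ` lifted to the modulus `Dp`. [cite: Zhang2022LandauSiegel, §4 p. 8] -/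
def psiChi : DirichletCharacter ℂ (D * x.p) :=
  DirichletCharacter.changeLevel (dvd_mul_right D x.p) χ *
    DirichletCharacter.changeLevel (dvd_mul_left x.p D) x.ψ

/-- The zeros of `L(s,ψ)L(s,ψχ)` in `Ω` (the set Proposition 2.2 is about).
[cite: Zhang2022LandauSiegel, §2 Prop. 2.2] -/
def prodZeroSetOmega : Set ℂ :=
  {s | s ∈ Omega D ∧ x.ψ.LFunction s * (psiChi χ x).LFunction s = 0}

open scoped Classical in
/-- **`Y(s,θ)`** (§2 p. 5): an analytic function on the upper half-plane with `Y² = Z(·,θ)⁻¹`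
(a choice, by `Classical.choose`, from the tree's `GammaFactor.exists_sqrt_inv_Zfac`; `0` for an
imprimitive `θ`, never used). [cite: Zhang2022LandauSiegel, §2 p. 5] -/
def Yroot {k : ℕ} [NeZero k] (θ : DirichletCharacter ℂ k) : ℂ → ℂ :=
  if h : θ.IsPrimitive then Classical.choose (GammaFactor.exists_sqrt_inv_Zfac h) else 0

/-- The defining properties of `Y(s,θ)` for primitive `θ`: analytic on `{Im s > 0}` and
`Y(s,θ)² = Z(s,θ)⁻¹` there. [cite: Zhang2022LandauSiegel, §2 p. 5] -/
theorem Yroot_spec {k : ℕ} [NeZero k] {θ : DirichletCharacter ℂ k} (h : θ.IsPrimitive) :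
    DifferentiableOn ℂ (Yroot θ) {s : ℂ | 0 < s.im} ∧
      ∀ s : ℂ, 0 < s.im → Yroot θ s ^ 2 = (GammaFactor.Zfac θ s)⁻¹ := by
  rw [Yroot, dif_pos h]
  exact Classical.choose_spec (GammaFactor.exists_sqrt_inv_Zfac h)

/-- **`M(s,θ) = Y(s,θ)L(s,θ)`** (§2 p. 5). [cite: Zhang2022LandauSiegel, §2 p. 5] -/
def Mfun {k : ℕ} [NeZero k] (θ : DirichletCharacter ℂ k) (s : ℂ) : ℂ := Yroot θ s * θ.LFunction s

omit [NeZero D] in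
/-- **`𝔠*(ρ,ψ) = −iM(ρ+β₁,ψ)M(ρ+β₂,ψ)M(ρ+β₃,ψ)/M′(ρ,ψ)`** (§2 p. 5, after (2.14)).
[cite: Zhang2022LandauSiegel, §2 p. 5] -/
def cstar (D : ℕ) (x : Chr D) (ρ : ℂ) : ℂ :=
  -I * Mfun x.ψ (ρ + beta1 c' D) * Mfun x.ψ (ρ + beta2 c' D) * Mfun x.ψ (ρ + beta3 c' D)
    / deriv (Mfun x.ψ) ρ

omit [NeZero D] in
/-- **`ω(s) = (√π/𝓛₂)exp{(s − s₀)²/(4𝓛₂²)}`** (2.15) (the tree's `SmoothWeight.omega`).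
[cite: Zhang2022LandauSiegel, §2 (2.15)] -/
def omegaW (D : ℕ) (s : ℂ) : ℂ := SmoothWeight.omega (ell2 D) (t0 D) s

/-! ## The Dirichlet polynomials (2.23)–(2.30), (8.6) -/

omit [NeZero D] in
/-- `ϰ₁(n) = (1 − log n/log P₁)(P₁/n)^{β₆}` for `n < P₁`, else `0` (8.6). [cite: Zhang2022LandauSiegel, §8 (8.6)] -/
def vk1 (D : ℕ) (n : ℕ) : ℂ :=
  if (n : ℝ) < P1 D then (1 - Real.log n / Real.log (P1 D) : ℝ) * ((P1 D / n : ℝ) : ℂ) ^ beta6 D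
  else 0

omit [NeZero D] in
/-- `ϰ₂(n) = (1 − log n/log P₂)(P₂/n)^{β₇}` for `n < P₂`, else `0` (8.6). [cite: Zhang2022LandauSiegel, §8 (8.6)] -/
def vk2 (D : ℕ) (n : ℕ) : ℂ :=
  if (n : ℝ) < P2 D then (1 - Real.log n / Real.log (P2 D) : ℝ) * ((P2 D / n : ℝ) : ℂ) ^ beta7 D
  else 0

omit [NeZero D] in
/-- `ϰ₃(n) = (1 − log n/log P₃)(P₃/n)^{β₆}` for `n < P₃`, else `0` (8.6). [cite: Zhang2022LandauSiegel, §8 (8.6)] -/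
def vk3 (D : ℕ) (n : ℕ) : ℂ :=
  if (n : ℝ) < P3 D then (1 - Real.log n / Real.log (P3 D) : ℝ) * ((P3 D / n : ℝ) : ℂ) ^ beta6 D
  else 0

/-- The coefficient `ψχ(n) = ψ(n)χ(n)`. [cite: Zhang2022LandauSiegel, §2 (2.23)] -/
def pc (n : ℕ) : ℂ := x.ψ (n : ZMod x.p) * χ (n : ZMod D)

/-- `H₁₁(s,ψ) = Σ_{n<P₁} ψχ(n)n^{−s}(1 − log n/log P₁)(P₁/n)^{β₆}` (2.23) = `Σ ϰ₁(n)ψχ(n)n^{−s}` (8.6).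
[cite: Zhang2022LandauSiegel, §2 (2.23)] -/
def H11 (s : ℂ) : ℂ := ∑ n ∈ Finset.Ico 1 ⌈P1 D⌉₊, vk1 D n * pc χ x n * (n : ℂ) ^ (-s)

/-- `H₁₂(s,ψ) = Σ_{n<P₂} ψχ(n)n^{−s}(1 − log n/log P₂)(P₂/n)^{β₇}` (2.24). [cite: Zhang2022LandauSiegel, §2 (2.24)] -/
def H12 (s : ℂ) : ℂ := ∑ n ∈ Finset.Ico 1 ⌈P2 D⌉₊, vk2 D n * pc χ x n * (n : ℂ) ^ (-s)

/-- `H₁₃(s,ψ) = Σ_{n<P₃} ψχ(n)n^{−s}(1 − log n/log P₃)(P₃/n)^{β₆}` (2.25). [cite: Zhang2022LandauSiegel, §2 (2.25)] -/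
def H13 (s : ℂ) : ℂ := ∑ n ∈ Finset.Ico 1 ⌈P3 D⌉₊, vk3 D n * pc χ x n * (n : ℂ) ^ (-s)

/-- **`H₁ = H₁₁ + ι₂H₁₂`** (2.27). [cite: Zhang2022LandauSiegel, §2 (2.27)] -/
def H1 (s : ℂ) : ℂ := H11 χ x s + iota2 * H12 χ x s

/-- **`H₂ = ῑ₃H₁₃ + ῑ₄H₁₂`** (2.27). [cite: Zhang2022LandauSiegel, §2 (2.27)] -/
def H2 (s : ℂ) : ℂ := conj iota3 * H13 χ x s + conj iota4 * H12 χ x s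

omit [NeZero D] in
/-- **The tent `f̃`** (2.28): `500(z − 0.5)` on `[0.5, 0.502]`, `500(0.504 − z)` on `[0.502, 0.504]`,
`0` otherwise. [cite: Zhang2022LandauSiegel, §2 (2.28)] -/
def ftilde (z : ℝ) : ℝ :=
  if 0.5 ≤ z ∧ z ≤ 0.502 then 500 * (z - 0.5)
  else if 0.502 ≤ z ∧ z ≤ 0.504 then 500 * (0.504 - z) else 0

/-- **`J₁(s,ψ) = Σ_n ψχ(n)n^{−s}f̃(log n/log P)`** (2.29) (a finite sum: `f̃` has compact support).
[cite: Zhang2022LandauSiegel, §2 (2.29)] -/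
def J1 (s : ℂ) : ℂ :=
  ∑ᶠ n : ℕ, pc χ x n * (n : ℂ) ^ (-s) * (ftilde (Real.log n / Real.log (bigP D)) : ℂ)

/-- **`J₂(s,ψ) = Σ_n ψχ(n)n^{−s}f̃(log n/log P + 0.004 − α̃)`**, `α̃ = log(Dt₀)/log P` (2.30).
[cite: Zhang2022LandauSiegel, §2 (2.30)] -/
def J2 (s : ℂ) : ℂ :=
  ∑ᶠ n : ℕ, pc χ x n * (n : ℂ) ^ (-s) *
    (ftilde (Real.log n / Real.log (bigP D) + 0.004 - alphaTilde D) : ℂ)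

/-- **`Z(s,ψχ)`**, the root number factor of the functional equation (2.2) for the primitive
character `ψχ (mod Dp)` (the tree's `GammaFactor.Zfac`). [cite: Zhang2022LandauSiegel, §2 (2.2)] -/
def Zpc (s : ℂ) : ℂ := GammaFactor.Zfac (psiChi χ x) s

/-! ## The discrete means -/

/-- The index set of the double sums `Σ_{ψ∈Ψ₁} Σ_{ρ∈𝔷(ψ)}`: pairs `(ψ, ρ)`, as a `Finset`.
[cite: Zhang2022LandauSiegel, §2 (2.16)] -/
def idx : Finset ((_ : Chr D) × ℂ) := (finsetOf (PsiOne χ)).sigma fun x => finsetOf (zeroSet D x)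

/-- **`Ξ₁* = Σ_{ψ∈Ψ₁}Σ_{ρ∈𝔷(ψ)} 𝔠*(ρ,ψ)(H₁(ρ,ψ)J̄₁(ρ,ψ) + H̄₂(ρ,ψ)J₂(ρ,ψ))ω(ρ)`** (2.17).
[cite: Zhang2022LandauSiegel, §2 (2.17)] -/
def xiStar1 : ℂ := ∑ i ∈ idx χ, cstar c' D i.1 i.2 *
  (H1 χ i.1 i.2 * conj (J1 χ i.1 i.2) + conj (H2 χ i.1 i.2) * J2 χ i.1 i.2) * omegaW D i.2

/-- **`Ξ₂* = ΣΣ 𝔠*(ρ,ψ)|H₁(ρ,ψ) + Z(ρ,ψχ)H̄₂(ρ,ψ)||J₁(ρ,ψ)|ω(ρ)`** (2.19).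
[cite: Zhang2022LandauSiegel, §2 (2.19)] -/
def xiStar2 : ℝ := ∑ i ∈ idx χ, (cstar c' D i.1 i.2).re *
  (‖H1 χ i.1 i.2 + Zpc χ i.1 i.2 * conj (H2 χ i.1 i.2)‖ * ‖J1 χ i.1 i.2‖) * (omegaW D i.2).re

/-- **`Ξ₃* = ΣΣ 𝔠*(ρ,ψ)|J₁(ρ,ψ) − Z(ρ,ψχ)J̄₂(ρ,ψ)||H₂(ρ,ψ)|ω(ρ)`** (2.20).
[cite: Zhang2022LandauSiegel, §2 (2.20)] -/
def xiStar3 : ℝ := ∑ i ∈ idx χ, (cstar c' D i.1 i.2).re *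
  (‖J1 χ i.1 i.2 - Zpc χ i.1 i.2 * conj (J2 χ i.1 i.2)‖ * ‖H2 χ i.1 i.2‖) * (omegaW D i.2).re

/-- **`Ξ₁ = ΣΣ 𝔠*(ρ,ψ)|H₁(ρ,ψ) + Z(ρ,ψχ)H̄₂(ρ,ψ)|²ω(ρ)`**, the left side of (2.32) (= (8.1)).
[cite: Zhang2022LandauSiegel, §2 (2.32)] -/
def xi1 : ℝ := ∑ i ∈ idx χ, (cstar c' D i.1 i.2).re *
  ‖H1 χ i.1 i.2 + Zpc χ i.1 i.2 * conj (H2 χ i.1 i.2)‖ ^ 2 * (omegaW D i.2).re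

/-- **`Ξ_J = ΣΣ 𝔠*(ρ,ψ)|J₁(ρ,ψ)|²ω(ρ)`**, the left side of (2.33).
[cite: Zhang2022LandauSiegel, §2 (2.33)] -/
def xiJ : ℝ := ∑ i ∈ idx χ, (cstar c' D i.1 i.2).re * ‖J1 χ i.1 i.2‖ ^ 2 * (omegaW D i.2).re

/-- **`Ξ₁₁ = ΣΣ 𝔠*|H₁|²ω`** (8.3). [cite: Zhang2022LandauSiegel, §8 (8.3)] -/
def xi11 : ℝ := ∑ i ∈ idx χ, (cstar c' D i.1 i.2).re * ‖H1 χ i.1 i.2‖ ^ 2 * (omegaW D i.2).re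

/-- **`Ξ₁₂ = ΣΣ 𝔠*|H₂|²ω`** (8.4). [cite: Zhang2022LandauSiegel, §8 (8.4)] -/
def xi12 : ℝ := ∑ i ∈ idx χ, (cstar c' D i.1 i.2).re * ‖H2 χ i.1 i.2‖ ^ 2 * (omegaW D i.2).re

/-- **`Ξ₁₃ = ΣΣ 𝔠*Z(ρ,ψχ)⁻¹H₁H₂ω`** (8.5). [cite: Zhang2022LandauSiegel, §8 (8.5)] -/
def xi13 : ℂ := ∑ i ∈ idx χ, cstar c' D i.1 i.2 * (Zpc χ i.1 i.2)⁻¹ *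
  (H1 χ i.1 i.2 * H2 χ i.1 i.2) * omegaW D i.2

/-- **`𝔞 = (6/π²)L′(1,χ)²∏_{q∣D} q/(q+1)`** (2.31) is the tree's `Lemma171.frakA χ`; re-exported
under the skeleton's name for the statements below. [cite: Zhang2022LandauSiegel, §2 (2.31)] -/
abbrev frakA : ℝ := Lemma171.frakA χ

end Literature.NumberTheory.LFunctions.Zhang2022.Skeleton
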